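import Mathlib
import Literature.NumberTheory.LFunctions.MultiplicativeCorrelations
import HarnessLib

/-!
# Tao's logarithmically averaged two-point Chowla theorem: reduction to the log-Elliott theorem

This file records the top of the proof DAG of

* `Literature.NumberTheory.Sieve.tao_log_chowla_liouville` (parity.S21; Tao, Forum Math. Pi 4 (2016) e8, Thm 1.2 with
  `ω(x) = x`): `∑_{n ≤ x} λ(a₁ n + b₁) λ(a₂ n + b₂) / n = o(log x)` for `a₁ b₂ ≠ a₂ b₁`.

Tao (2016, §1 after Remark 1.6, and §2, first paragraph) obtains Theorem 1.2 as the special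
case `g₁ = g₂ = λ` of the logarithmically averaged non-asymptotic Elliott theorem (Theorem 1.3,
vendored as the named fact `Literature.NumberTheory.LFunctions.tao_log_averaged_elliott_two`), the hypothesis of Theorem 1.3
for `λ` — that `λ` does not pretend to be `χ(n) n^{it}` for `q ≤ A`, `|t| ≤ A x` — being supplied
by the Vinogradov–Korobov zero-free region, in the form of the bound for `M(λ; X, Q)` printed in
Matomäki–Radziwiłł–Tao (2015), §1, eq. (1.12) (the numbered display for `g = λ` following
Theorem 1.6), referred to below as "MRT (1.12)".

Contents:
* `Literature.NumberTheory.LFunctions.MatomakiRadziwillTao2015_liouvilleDistLowerBound` — NAMED FACT (MRT 2015, §1, (1.12),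
  the display after Thm 1.6): for `q ≤ log^{1/125} X`, `|t| ≤ X`,
  `∑_{exp((log X)^{2/3+ε}) ≤ p ≤ X} (1 + Re χ(p) p^{it}) / p ≥ (1/3 - ε) log log X + O(1)`.
* `Literature.NumberTheory.LFunctions.Tao2016_liouvilleNonpretentious` — the statement that `λ` satisfies hypothesis (1.6) of
  Tao's Theorem 1.3 at every level `A` for all large `x` (Tao 2016, §1), as a `Prop`;
  PROVED here from the MRT fact (`Tao2016_liouvilleNonpretentious_of_MRT`).
* `Literature.NumberTheory.LFunctions.tao_log_chowla_liouville_of_elliott` — PROVED: Theorem 1.3 (the fact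
  `tao_log_averaged_elliott_two`) together with `Tao2016_liouvilleNonpretentious` implies
  `Literature.NumberTheory.Sieve.tao_log_chowla_liouville`.
* `Literature.NumberTheory.LFunctions.isNonpretentious_liouville_of_MRT` — PROVED: the MRT fact implies the named fact
  `Literature.NumberTheory.Sieve.isNonpretentious_liouville` of `PretentiousDistance` (per-character `M_χ(λ; x) → ∞`).

Thus `tao_log_chowla_liouville` is reduced to the two named facts `tao_log_averaged_elliott_two`
(Tao 2016, Thm 1.3) and `MatomakiRadziwillTao2015_liouvilleDistLowerBound` (MRT 2015, §1)
(`Parity.tao_log_chowla_liouville_of_facts`).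

## References
* T. Tao, *The logarithmically averaged Chowla and Elliott conjectures for two-point
  correlations*, Forum Math. Pi 4 (2016), e8; arXiv:1509.05422. Theorems 1.2, 1.3, §1, §2.
* K. Matomäki, M. Radziwiłł, T. Tao, *An averaged form of Chowla's conjecture*, Algebra & Number
  Theory 9 (2015), 2167–2196; arXiv:1503.05121. §1, eq. (1.12) (display following Theorem 1.6).

## Design choices
* The Liouville function as a complex arithmetic function is the coercion
  `(ArithmeticFunction.liouville : ArithmeticFunction ℂ)` of Mathlib's `ℤ`-valued `liouville`;
  no new definition.
* MRT (1.12) is transcribed with the prime range `exp((log X)^{2/3+ε}) ≤ p ≤ X` as printed; the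
  `O(1)` is read as a constant depending on `ε` and the bound is asserted for `X ≥ X₀(ε)` (the
  weakest reading of the printed asymptotic statement). Its corollary for the full
  Granville–Soundararajan distance `𝔻(λ, χ(n)n^{it}; X)² = ∑_{p ≤ X} (1 + Re χ(p)p^{it})/p`
  (`Literature.NumberTheory.Sieve.pretentiousDistSq`) is proved (`….pretentiousDistSq_ge`).
-/

open Filter Asymptotics Finset Complex

namespace Literature.NumberTheory.LFunctions

/-! ### The Liouville function as a complex arithmetic function: basic facts -/

/-- `λ(p) = -1` at a prime `p` (as a complex number). [folklore] -/
theorem liouville_complex_apply_prime {p : ℕ} (hp : p.Prime) :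
    (ArithmeticFunction.liouville : ArithmeticFunction ℂ) p = -1 := by
  rw [ArithmeticFunction.intCoe_apply, ArithmeticFunction.liouville_apply hp.ne_zero,
    ArithmeticFunction.cardFactors_apply_prime hp]
  simp

/-- `|λ(n)| ≤ 1` (as a complex number). [folklore] -/
theorem norm_liouville_complex_le_one (n : ℕ) :
    ‖(ArithmeticFunction.liouville : ArithmeticFunction ℂ) n‖ ≤ 1 := by
  rw [ArithmeticFunction.intCoe_apply]
  rcases eq_or_ne n 0 with rfl | hn
  · simp
  · rw [ArithmeticFunction.liouville_apply hn]
    simp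

/-- The complex Liouville function is multiplicative. [folklore] -/
theorem isMultiplicative_liouville_complex :
    (ArithmeticFunction.liouville : ArithmeticFunction ℂ).IsMultiplicative :=
  ArithmeticFunction.isMultiplicative_liouville.intCast

/-- At a prime `p`, the summand of `𝔻(λ, χ(n)n^{it}; X)²` is `(1 + Re χ(p) p^{it}) / p`.
[folklore] -/
theorem liouville_pretentious_summand {q : ℕ} (χ : DirichletCharacter ℂ q) (t : ℝ) {p : ℕ}
    (hp : p.Prime) :
    (1 - ((ArithmeticFunction.liouville : ArithmeticFunction ℂ) p *
        (starRingEnd ℂ) (Sieve.twistedChar χ t p)).re) / (p : ℝ)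
      = (1 + (χ p * (p : ℂ) ^ ((t : ℂ) * I)).re) / (p : ℝ) := by
  rw [liouville_complex_apply_prime hp]
  simp [Sieve.twistedChar, Complex.conj_re]
  ring

/-- The summand `(1 + Re χ(p) p^{it}) / p` lies in `[0, 2/p]`. [folklore] -/
theorem liouville_pretentious_summand_mem {q : ℕ} (χ : DirichletCharacter ℂ q) (t : ℝ) {p : ℕ}
    (hp : p.Prime) :
    0 ≤ (1 + (χ p * (p : ℂ) ^ ((t : ℂ) * I)).re) / (p : ℝ) ∧
      (1 + (χ p * (p : ℂ) ^ ((t : ℂ) * I)).re) / (p : ℝ) ≤ 2 / (p : ℝ) := by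
  -- `‖χ(p) p^{it}‖ ≤ 1` (cf. `Literature.NumberTheory.Sieve.norm_twistedChar_le_one`; inlined to keep this file
  -- independent of the olean vintage of `PretentiousDistance`)
  have h1 : ‖χ p * (p : ℂ) ^ ((t : ℂ) * I)‖ ≤ 1 := by
    rw [norm_mul, Complex.norm_natCast_cpow_of_pos hp.pos]
    simp only [mul_re, ofReal_re, I_re, mul_zero, ofReal_im, I_im, mul_one, sub_self,
      Real.rpow_zero, mul_one]
    exact χ.norm_le_one _
  have h2 : |(χ p * (p : ℂ) ^ ((t : ℂ) * I)).re| ≤ 1 := (Complex.abs_re_le_norm _).trans h1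
  rw [abs_le] at h2
  have hp0 : (0 : ℝ) < p := by exact_mod_cast hp.pos
  constructor
  · exact div_nonneg (by linarith) hp0.le
  · exact div_le_div_of_nonneg_right (by linarith) hp0.le

/-! ### Named fact: MRT (2015), §1, the bound for `λ` after Theorem 1.6 -/

/-- NAMED FACT — **Matomäki–Radziwiłł–Tao 2015, non-pretentiousness of `λ`** (Algebra & Number
Theory 9 (2015), §1, eq. (1.12), the numbered display following Theorem 1.6): "For
`g(n) = λ(n)` and `X, Q, M` as in the above theorem [`Q ≤ log^{1/125} X`], one obtains, for every
`ε > 0`, the bound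
`M ≥ inf_{|t| ≤ X; q ≤ Q; χ (q)} ∑_{exp((log X)^{2/3+ε}) ≤ p ≤ X} (1 + Re χ(p) p^{it}) / p
≥ (1/3 - ε) log log X + O(1)`, where the last inequality is established via standard methods
from the Vinogradov–Korobov type zero-free region … for `L(s, χ)` …, which applies since `χ` has
conductor `q ≤ (log X)^{1/125}` (so that there are no exceptional zeros), see [Montgomery]."
Transcribed: for every `ε > 0` there are `C, X₀` such that for `X ≥ X₀`, every modulus
`1 ≤ q ≤ (log X)^{1/125}`, every Dirichlet character `χ` mod `q` and every `|t| ≤ X`,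
`(1/3 - ε) log log X - C ≤ ∑_{p ≤ X prime, exp((log X)^{2/3+ε}) ≤ p} (1 + Re χ(p) p^{it}) / p`.
Users take `(h : MatomakiRadziwillTao2015_liouvilleDistLowerBound)`.
[cite: MatomakiRadziwillTao2015, §1 (1.12) (display following Theorem 1.6)] -/
def MatomakiRadziwillTao2015_liouvilleDistLowerBound : Prop :=
  ∀ ε : ℝ, 0 < ε → ∃ C X₀ : ℝ, ∀ X : ℝ, X₀ ≤ X →
    ∀ (q : ℕ) (χ : DirichletCharacter ℂ q) (t : ℝ), 1 ≤ q →
      (q : ℝ) ≤ Real.log X ^ (1 / 125 : ℝ) → |t| ≤ X →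
      (1 / 3 - ε) * Real.log (Real.log X) - C ≤
        ∑ p ∈ (Nat.primesLE ⌊X⌋₊).filter (fun p : ℕ => Real.exp (Real.log X ^ (2 / 3 + ε)) ≤ p),
          (1 + (χ p * (p : ℂ) ^ ((t : ℂ) * I)).re) / (p : ℝ)

/-- `𝔻(λ, χ(n) n^{it}; X)² = ∑_{p ≤ X} (1 + Re χ(p) p^{it}) / p`. [folklore] -/
theorem pretentiousDistSq_liouville_eq {q : ℕ} (χ : DirichletCharacter ℂ q) (t X : ℝ) :
    Sieve.pretentiousDistSq (ArithmeticFunction.liouville : ArithmeticFunction ℂ) (Sieve.twistedChar χ t) X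
      = ∑ p ∈ Nat.primesLE ⌊X⌋₊, (1 + (χ p * (p : ℂ) ^ ((t : ℂ) * I)).re) / (p : ℝ) := by
  unfold Sieve.pretentiousDistSq
  refine Finset.sum_congr rfl fun p hp => ?_
  exact liouville_pretentious_summand χ t (Nat.mem_primesLE.1 hp).2

/-- **MRT (1.12) ⇒ lower bound for the full distance.** Since every summand is nonnegative,
`𝔻(λ, χ(n)n^{it}; X)² ≥ (1/3 - ε) log log X - C` in the same range of `q, χ, t`.
[cite: MatomakiRadziwillTao2015, §1 (1.12) (display following Theorem 1.6)] -/
theorem MatomakiRadziwillTao2015_liouvilleDistLowerBound.pretentiousDistSq_ge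
    (h : MatomakiRadziwillTao2015_liouvilleDistLowerBound) (ε : ℝ) (hε : 0 < ε) :
    ∃ C X₀ : ℝ, ∀ X : ℝ, X₀ ≤ X →
      ∀ (q : ℕ) (χ : DirichletCharacter ℂ q) (t : ℝ), 1 ≤ q →
        (q : ℝ) ≤ Real.log X ^ (1 / 125 : ℝ) → |t| ≤ X →
        (1 / 3 - ε) * Real.log (Real.log X) - C ≤
          Sieve.pretentiousDistSq (ArithmeticFunction.liouville : ArithmeticFunction ℂ)
            (Sieve.twistedChar χ t) X := by
  obtain ⟨C, X₀, hC⟩ := h ε hε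
  refine ⟨C, X₀, fun X hX q χ t hq hqX ht => (hC X hX q χ t hq hqX ht).trans ?_⟩
  rw [pretentiousDistSq_liouville_eq]
  refine Finset.sum_le_sum_of_subset_of_nonneg (Finset.filter_subset _ _) fun p hp _ => ?_
  exact (liouville_pretentious_summand_mem χ t (Nat.mem_primesLE.1 hp).2).1

/-! ### `λ` satisfies the hypothesis of Tao's Theorem 1.3 -/

/-- **`λ` is non-pretentious in the sense of Tao 2016, (1.6)/(1.8)** (Tao, Forum Math. Pi 4
(2016) e8, §1, after Remark 1.6: "Using Vinogradov-Korobov error term zero-free region for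
`L`-functions (see [mont]), it is not difficult to establish (1.8) when `g` is the Liouville
function; see [mrn] for a closely related calculation. Thus Corollary 1.5 implies Theorem 1.2.").
Here (1.8) is the hypothesis of Corollary 1.5 and (1.6) that of Theorem 1.3; for `λ` we state the
Theorem-1.3 form at every level `A` (equivalent to (1.8) for `λ`, finitely many `χ` of modulus
`≤ A`): for every `A`, for all sufficiently large `x`, `𝔻(λ, χ(n) n^{it}; x)² ≥ A` for all moduli
`1 ≤ q ≤ A`, all Dirichlet characters `χ` mod `q` and all `|t| ≤ A x` — exactly the hypothesis of
`Literature.NumberTheory.LFunctions.tao_log_averaged_elliott_two` for `g₁ = λ`. Proved below from MRT (1.12)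
(`Tao2016_liouvilleNonpretentious_of_MRT`).
[cite: TaoFMP2016, §1 after Remark 1.6 (hypotheses (1.6)/(1.8) for λ)] -/
def Tao2016_liouvilleNonpretentious : Prop :=
  ∀ A : ℝ, ∀ᶠ x : ℝ in atTop,
    ∀ (q : ℕ) (χ : DirichletCharacter ℂ q) (t : ℝ), 1 ≤ q → (q : ℝ) ≤ A → |t| ≤ A * x →
      A ≤ Sieve.pretentiousDistSq (ArithmeticFunction.liouville : ArithmeticFunction ℂ)
        (Sieve.twistedChar χ t) x

/-- Enlarging the height from `x` to `X ≥ x` increases `𝔻(λ, χ(n)n^{it}; ·)²` by at most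
`2 (⌊X⌋₊ - ⌊x⌋₊) / (⌊x⌋₊ + 1)` (each new prime `⌊x⌋₊ < p ≤ ⌊X⌋₊` contributes at most `2/p`).
[folklore] -/
theorem pretentiousDistSq_liouville_mono_add {q : ℕ} (χ : DirichletCharacter ℂ q) (t : ℝ)
    {x X : ℝ} (hxX : x ≤ X) :
    Sieve.pretentiousDistSq (ArithmeticFunction.liouville : ArithmeticFunction ℂ) (Sieve.twistedChar χ t) X
      ≤ Sieve.pretentiousDistSq (ArithmeticFunction.liouville : ArithmeticFunction ℂ) (Sieve.twistedChar χ t) x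
        + 2 * ((⌊X⌋₊ : ℝ) - ⌊x⌋₊) / ((⌊x⌋₊ : ℝ) + 1) := by
  rw [pretentiousDistSq_liouville_eq, pretentiousDistSq_liouville_eq]
  have hsub : Nat.primesLE ⌊x⌋₊ ⊆ Nat.primesLE ⌊X⌋₊ := by
    intro p hp
    rw [Nat.mem_primesLE] at hp ⊢
    exact ⟨hp.1.trans (Nat.floor_le_floor hxX), hp.2⟩
  rw [← Finset.sum_sdiff hsub, add_comm]
  gcongr
  -- the new primes lie in `Ioc ⌊x⌋₊ ⌊X⌋₊` and each contributes at most `2 / (⌊x⌋₊ + 1)`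
  have hdiff : Nat.primesLE ⌊X⌋₊ \ Nat.primesLE ⌊x⌋₊ ⊆ Ioc ⌊x⌋₊ ⌊X⌋₊ := by
    intro p hp
    rw [Finset.mem_sdiff, Nat.mem_primesLE, Nat.mem_primesLE] at hp
    rw [Finset.mem_Ioc]
    exact ⟨not_le.1 fun h => hp.2 ⟨h, hp.1.2⟩, hp.1.1⟩
  have hbound : ∀ p ∈ Nat.primesLE ⌊X⌋₊ \ Nat.primesLE ⌊x⌋₊,
      (1 + (χ p * (p : ℂ) ^ ((t : ℂ) * I)).re) / (p : ℝ) ≤ 2 / ((⌊x⌋₊ : ℝ) + 1) := by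
    intro p hp
    have hp' := hdiff hp
    rw [mem_Ioc] at hp'
    have hprime : p.Prime := (Nat.mem_primesLE.1 (mem_sdiff.1 hp).1).2
    refine (liouville_pretentious_summand_mem χ t hprime).2.trans ?_
    gcongr
    exact_mod_cast hp'.1
  calc ∑ p ∈ Nat.primesLE ⌊X⌋₊ \ Nat.primesLE ⌊x⌋₊,
        (1 + (χ p * (p : ℂ) ^ ((t : ℂ) * I)).re) / (p : ℝ)
      ≤ ∑ _p ∈ Nat.primesLE ⌊X⌋₊ \ Nat.primesLE ⌊x⌋₊, 2 / ((⌊x⌋₊ : ℝ) + 1) :=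
        Finset.sum_le_sum hbound
    _ = ((Nat.primesLE ⌊X⌋₊ \ Nat.primesLE ⌊x⌋₊).card : ℝ) * (2 / ((⌊x⌋₊ : ℝ) + 1)) := by
        rw [Finset.sum_const, nsmul_eq_mul]
    _ ≤ ((⌊X⌋₊ : ℝ) - ⌊x⌋₊) * (2 / ((⌊x⌋₊ : ℝ) + 1)) := by
        gcongr
        have := Finset.card_le_card hdiff
        rw [Nat.card_Ioc] at this
        have hle : ⌊x⌋₊ ≤ ⌊X⌋₊ := Nat.floor_le_floor hxX
        exact_mod_cast (Nat.cast_sub (R := ℝ) hle) ▸ (Nat.cast_le.2 this)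
    _ = 2 * ((⌊X⌋₊ : ℝ) - ⌊x⌋₊) / ((⌊x⌋₊ : ℝ) + 1) := by ring

/-- **MRT (1.12) ⇒ `λ` satisfies Tao's hypothesis (1.6).** Given `A`, apply MRT (1.12) with
`ε = 1/6` at height `X = max(A,1) · x`: for `x` large, `q ≤ A ≤ (log X)^{1/125}` and
`|t| ≤ A x ≤ X`, so `𝔻(λ, χ n^{it}; X)² ≥ (1/6) log log X - C`, while
`𝔻(·; X)² ≤ 𝔻(·; x)² + 2 max(A,1)`; hence `𝔻(λ, χ n^{it}; x)² → ∞` uniformly in the stated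
range. (Tao 2016, §1.) [cite: TaoFMP2016, §1 after Remark 1.6 (hypotheses (1.6)/(1.8) for λ)] -/
theorem Tao2016_liouvilleNonpretentious_of_MRT
    (h : MatomakiRadziwillTao2015_liouvilleDistLowerBound) : Tao2016_liouvilleNonpretentious := by
  intro A
  set A' : ℝ := max A 1 with hA'
  have hA'1 : 1 ≤ A' := le_max_right _ _
  have hA'0 : 0 < A' := one_pos.trans_le hA'1
  obtain ⟨C, X₀, hC⟩ := h.pretentiousDistSq_ge (1 / 6) (by norm_num)
  -- the three "x large" conditions
  have hX : Tendsto (fun x : ℝ => A' * x) atTop atTop := Tendsto.const_mul_atTop hA'0 tendsto_id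
  have e1 : ∀ᶠ x : ℝ in atTop, X₀ ≤ A' * x := hX.eventually (eventually_ge_atTop X₀)
  have e2 : ∀ᶠ x : ℝ in atTop, A' ≤ Real.log (A' * x) ^ (1 / 125 : ℝ) :=
    ((tendsto_rpow_atTop (by norm_num : (0 : ℝ) < 1 / 125)).comp
      (Real.tendsto_log_atTop.comp hX)).eventually (eventually_ge_atTop A')
  have e3 : ∀ᶠ x : ℝ in atTop,
      A + C + 2 * A' ≤ (1 / 3 - 1 / 6) * Real.log (Real.log (A' * x)) := by
    have : Tendsto (fun x : ℝ => (1 / 3 - 1 / 6) * Real.log (Real.log (A' * x))) atTop atTop :=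
      Tendsto.const_mul_atTop (by norm_num)
        (Real.tendsto_log_atTop.comp (Real.tendsto_log_atTop.comp hX))
    exact this.eventually (eventually_ge_atTop _)
  filter_upwards [e1, e2, e3, eventually_gt_atTop 0] with x hx1 hx2 hx3 hx0
  intro q χ t hq hqA htA
  have hxX : x ≤ A' * x := le_mul_of_one_le_left hx0.le hA'1
  have hqX : (q : ℝ) ≤ Real.log (A' * x) ^ (1 / 125 : ℝ) :=
    hqA.trans ((le_max_left A 1).trans hx2)
  have htX : |t| ≤ A' * x := htA.trans (by gcongr; exact le_max_left A 1)
  have hlow := hC (A' * x) hx1 q χ t hq hqX htX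
  have hmono := pretentiousDistSq_liouville_mono_add χ t hxX
  -- `2 (⌊A' x⌋₊ - ⌊x⌋₊) / (⌊x⌋₊ + 1) ≤ 2 A'`
  have herr : 2 * ((⌊A' * x⌋₊ : ℝ) - ⌊x⌋₊) / ((⌊x⌋₊ : ℝ) + 1) ≤ 2 * A' := by
    have hfl0 : (0 : ℝ) < (⌊x⌋₊ : ℝ) + 1 := by positivity
    rw [div_le_iff₀ hfl0]
    have h1 : (⌊A' * x⌋₊ : ℝ) ≤ A' * x := Nat.floor_le (by positivity)
    have h2 : x < (⌊x⌋₊ : ℝ) + 1 := Nat.lt_floor_add_one x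
    have h3 : (0 : ℝ) ≤ ⌊x⌋₊ := Nat.cast_nonneg _
    nlinarith
  linarith

/-! ### Theorem 1.3 + non-pretentiousness of `λ` ⇒ Theorem 1.2 (`ω(x) = x`) -/

/-- **Tao 2016, Theorem 1.3 ⇒ Theorem 1.2 (parity.S21).** The logarithmically averaged
non-asymptotic Elliott theorem `Literature.NumberTheory.LFunctions.tao_log_averaged_elliott_two` (Tao 2016, Thm 1.3), applied
with `g₁ = g₂ = λ` and `ω = x` — legitimate once `λ` satisfies hypothesis (1.6)
(`Tao2016_liouvilleNonpretentious`) — gives `|∑_{1 < n ≤ x} λ(a₁n+b₁)λ(a₂n+b₂)/n| ≤ ε log x` for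
`x` large; the term `n = 1` is at most `1 = o(log x)`. (Tao 2016, §1 and §2: "Theorem 1.2 is a
special case of Corollary 1.5, which is in turn a corollary of Theorem 1.3.")
[cite: TaoFMP2016, Theorem 1.2 (deduction from Theorem 1.3: §1 after Remark 1.6, and §2)] -/
theorem tao_log_chowla_liouville_of_elliott (hE : tao_log_averaged_elliott_two)
    (hL0 : Tao2016_liouvilleNonpretentious) : Sieve.tao_log_chowla_liouville := by
  intro a₁ a₂ b₁ b₂ ha₁ ha₂ hab
  refine Asymptotics.isLittleO_iff.2 fun c hc => ?_
  obtain ⟨A₀, hA₀⟩ := hE a₁ a₂ b₁ b₂ ha₁ ha₂ hab (c / 2) (half_pos hc)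
  set A : ℝ := max A₀ 1 with hA
  set L : ArithmeticFunction ℂ := (ArithmeticFunction.liouville : ArithmeticFunction ℂ) with hL
  have h1 : ∀ᶠ x : ℕ in atTop, ∀ (q : ℕ) (χ : DirichletCharacter ℂ q) (t : ℝ), 1 ≤ q →
      (q : ℝ) ≤ A → |t| ≤ A * (x : ℝ) → A ≤ Sieve.pretentiousDistSq L (Sieve.twistedChar χ t) (x : ℝ) :=
    tendsto_natCast_atTop_atTop.eventually (hL0 A)
  have h2 : ∀ᶠ x : ℕ in atTop, A ≤ (x : ℝ) :=
    tendsto_natCast_atTop_atTop.eventually (eventually_ge_atTop A)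
  have h3 : ∀ᶠ x : ℕ in atTop, 2 / c ≤ Real.log (x : ℝ) :=
    (Real.tendsto_log_atTop.comp tendsto_natCast_atTop_atTop).eventually (eventually_ge_atTop _)
  filter_upwards [h1, h2, h3, eventually_ge_atTop 1] with x hx1 hx2 hx3 hx4
  have hx0 : (0 : ℝ) < x := by exact_mod_cast hx4
  have key := hA₀ A (le_max_left _ _) x x hx2 le_rfl L L isMultiplicative_liouville_complex
    isMultiplicative_liouville_complex norm_liouville_complex_le_one norm_liouville_complex_le_one
    hx1
  rw [div_self hx0.ne', Nat.floor_one, Nat.floor_natCast] at key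
  -- identify the complex sum with the real one
  have hcast : (∑ n ∈ Ioc 1 x, L (a₁ * n + b₁) * L (a₂ * n + b₂) / (n : ℂ))
      = ((∑ n ∈ Ioc 1 x, (ArithmeticFunction.liouville (a₁ * n + b₁) *
          ArithmeticFunction.liouville (a₂ * n + b₂) : ℝ) / n : ℝ) : ℂ) := by
    rw [hL]
    push_cast
    refine Finset.sum_congr rfl fun n _ => ?_
    simp only [ArithmeticFunction.intCoe_apply]
  rw [hcast, Complex.norm_real] at key
  -- split off the term `n = 1`
  have hsplit : (∑ n ∈ Icc 1 x, (ArithmeticFunction.liouville (a₁ * n + b₁) *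
        ArithmeticFunction.liouville (a₂ * n + b₂) : ℝ) / n)
      = (ArithmeticFunction.liouville (a₁ * 1 + b₁) *
          ArithmeticFunction.liouville (a₂ * 1 + b₂) : ℝ) / (1 : ℕ)
        + ∑ n ∈ Ioc 1 x, (ArithmeticFunction.liouville (a₁ * n + b₁) *
          ArithmeticFunction.liouville (a₂ * n + b₂) : ℝ) / n := by
    rw [← Finset.Ioc_insert_left hx4, Finset.sum_insert Finset.left_notMem_Ioc]
  have hfirst : ‖(ArithmeticFunction.liouville (a₁ * 1 + b₁) *
      ArithmeticFunction.liouville (a₂ * 1 + b₂) : ℝ) / (1 : ℕ)‖ ≤ 1 := by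
    rw [Nat.cast_one, div_one, norm_mul]
    have hb : ∀ m : ℕ, ‖(ArithmeticFunction.liouville m : ℝ)‖ ≤ 1 := fun m => by
      have := norm_liouville_complex_le_one m
      rwa [ArithmeticFunction.intCoe_apply, Complex.norm_intCast, ← Real.norm_eq_abs] at this
    exact mul_le_one₀ (hb _) (norm_nonneg _) (hb _)
  have hlog : 0 ≤ Real.log (x : ℝ) := Real.log_natCast_nonneg x
  have hclog : 1 ≤ c / 2 * Real.log (x : ℝ) := by
    rw [div_le_iff₀ hc] at hx3
    linarith
  rw [hsplit, Real.norm_of_nonneg hlog]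
  calc ‖(ArithmeticFunction.liouville (a₁ * 1 + b₁) *
          ArithmeticFunction.liouville (a₂ * 1 + b₂) : ℝ) / (1 : ℕ)
        + ∑ n ∈ Ioc 1 x, (ArithmeticFunction.liouville (a₁ * n + b₁) *
          ArithmeticFunction.liouville (a₂ * n + b₂) : ℝ) / n‖
      ≤ 1 + c / 2 * Real.log (x : ℝ) := (norm_add_le _ _).trans (add_le_add hfirst key)
    _ ≤ c * Real.log (x : ℝ) := by linarith

/-- The two named facts `tao_log_averaged_elliott_two` (Tao 2016, Thm 1.3) and
`MatomakiRadziwillTao2015_liouvilleDistLowerBound` (MRT 2015, §1) together imply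
`Literature.NumberTheory.Sieve.tao_log_chowla_liouville` (Tao 2016, Thm 1.2 with `ω(x) = x`).
[cite: TaoFMP2016, Theorem 1.2 (deduction from Theorem 1.3: §1 after Remark 1.6, and §2)] -/
theorem tao_log_chowla_liouville_of_facts (hE : tao_log_averaged_elliott_two)
    (hM : MatomakiRadziwillTao2015_liouvilleDistLowerBound) : Sieve.tao_log_chowla_liouville :=
  LFunctions.tao_log_chowla_liouville_of_elliott hE (Tao2016_liouvilleNonpretentious_of_MRT hM)

/-! ### MRT bound ⇒ `Literature.NumberTheory.Sieve.isNonpretentious_liouville` -/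

/-- **MRT (2015) ⇒ `λ` is non-pretentious per fixed character** (`Literature.NumberTheory.Sieve.isNonpretentious_liouville`,
PretentiousDistance): for fixed `q ≥ 1` and `χ` mod `q`,
`M_χ(λ; x) = inf_{|t| ≤ x} 𝔻(λ, χ n^{it}; x)² ≥ (1/6) log log x - C → ∞`, since eventually
`q ≤ (log x)^{1/125}`.
(Matomäki–Radziwiłł–Tao 2015, §1, discussion after Conjecture 1.5 and the display after
Theorem 1.6.) [cite: MatomakiRadziwillTao2015, §1 (1.12) (display following Theorem 1.6)] -/
theorem isNonpretentious_liouville_of_MRT (h : MatomakiRadziwillTao2015_liouvilleDistLowerBound) :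
    Sieve.isNonpretentious_liouville := by
  intro q _ χ
  have hfun : (fun n ↦ (ArithmeticFunction.liouville n : ℂ))
      = ⇑(ArithmeticFunction.liouville : ArithmeticFunction ℂ) := by
    funext n; simp [ArithmeticFunction.intCoe_apply]
  obtain ⟨C, X₀, hC⟩ := h.pretentiousDistSq_ge (1 / 6) (by norm_num)
  have hq1 : 1 ≤ q := NeZero.one_le
  refine tendsto_atTop.2 fun B => ?_
  have e1 : ∀ᶠ x : ℝ in atTop, X₀ ≤ x := eventually_ge_atTop X₀
  have e2 : ∀ᶠ x : ℝ in atTop, (q : ℝ) ≤ Real.log x ^ (1 / 125 : ℝ) :=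
    ((tendsto_rpow_atTop (by norm_num : (0 : ℝ) < 1 / 125)).comp
      Real.tendsto_log_atTop).eventually (eventually_ge_atTop (q : ℝ))
  have e3 : ∀ᶠ x : ℝ in atTop, B + C ≤ (1 / 3 - 1 / 6) * Real.log (Real.log x) :=
    (Tendsto.const_mul_atTop (by norm_num)
      (Real.tendsto_log_atTop.comp Real.tendsto_log_atTop)).eventually (eventually_ge_atTop _)
  filter_upwards [e1, e2, e3, eventually_ge_atTop 0] with x hx1 hx2 hx3 hx0
  have hne : Nonempty (Set.Icc (-x) x) := ⟨⟨0, by simp [hx0]⟩⟩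
  rw [hfun]
  refine le_ciInf fun t => ?_
  have ht : |(t : ℝ)| ≤ x := abs_le.2 t.2
  have := hC x hx1 q χ t hq1 hx2 ht
  linarith

end Literature.NumberTheory.LFunctions
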